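import Summits.BirchSwinnertonDyer.BirchSwinnertonDyer.Theorems.KimAtThreeFineKatoLevelCompat
import HarnessLib

/-!
# The PER-FACTOR COMPAT clause of the defined-Kato package (crux `KatoKuriharaPortThreeShared`,
# stmt-BirchSwinnertonDyer-19560, registered stub `stub_definedKatoPackage` = hK) at ONE completion
# `F = K_w` of the level field — Galois side (cell `bsd-addord`, seat w2-acc5 gen 4; route W2
# `KimAtThreeKolyvagin`; `--supports 19560`, helper)

HONEST FRAMING. TOOL theorems only (no definition, no named fact, no `sorry`); closes nothing; nothing
is booked; BSD is not proved by any of this.  The 19560 LEAD (kim3 gen 14, HOME STATUS l.1162) splits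
hK's semi-local package into a PER-FACTOR package over the completions `L_w` (`w ∣ p` of `ℚ(ζ_m)`),
transported along w2-acc4's `Ψ : ℚ_p ⊗ ℚ(ζ_m) ≃ ∏_w L_w`; its per-factor COMPAT clause is SCALAR-valued in
`L_w`: «`∃ μ_w ∈ M_w, e_p(φ h) − (Ψ(Λ_{0,r} y))_w = p^{j+1}·μ_w`» whenever `res_U κ₀ = Ψ′ y` and
`loc_v κ₀ = π_{j+1,*} h`.  THIS FILE proves that clause at a single field `F ⊇ ℚ_v` whose tower
restriction `Γ_F → Γ_{ℚ_v} → Γ_ℚ` lands in the level `U = cycSubgroup p k r` (true when `F ∋ ζ_m`,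
`KimAtThreeFineKatoLevelCompat.absGaloisRestrictTower_mem_cycSubgroup`), for ANY additive
`φ_F : H¹(Γ_F, T_pE) →+ V` on the tower-restricted Tate module (intended: `exp*_ω` over `F = L_w`,
`V = L_w`), ANY additive «`w`-component of `Λ`» `L_F : H¹(U, T_pE) →+ V` and ANY additive
`e : H¹(ℚ_v, T_pE) →+ V` (intended `algebraMap ℚ_p L_w ∘ exp*_ω`), from the two definitional properties
(DEF_w) `L_F y = φ_F(loc_w^{tower} y)` (on cocycles) and (RES_w) `φ_F(res_{F/ℚ_v} h) = e h`:

* `exists_sub_eq_zsmul_apply_of_factorDef` — **`∃ y′ ∈ H¹(Γ_F, T_pE), e h − L_F y = p^{j+1} · φ_F y′`**;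
  so `μ_w := φ_F y′` lies in any lattice `M_w ⊇ range φ_F` (`exists_mem_sub_eq_zsmul_of_factorDef`).

The proof is the single-factor case of `KimAtThreeFineKatoLevelCompat.compat_of_semiLocalDef`:
`π_{j+1,*}(res_w h) = res_w(loc_v κ₀) = loc_w^{tower}(res_U κ₀) = loc_w^{tower}(Ψ′ y) = π_{j+1,*}(loc_w y)`
(`LevelFieldLocalization.locTower_resSubgroup`, cocycle formulas), exactness over `Γ_F`
(`exists_sub_eq_zsmul_tower`), then `φ_F`.  Every `p`, `v`, `j`, `(k, r)`, `F`.

References: K. Kato, Astérisque 295 (2004) §9.4, Thm. 9.7 [Kato2004Asterisque]; C.-H. Kim, AJM 148 (2026)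
§3.4.1, proof of Thm. 3.13 [Kim2022StructureSelmer]; kim3 `Theorems/KimAtThreeFineKatoRiderAssembly.lean`
(p490927) and HOME STATUS l.1162 (per-factor package).
-/

noncomputable section

-- the cell's Theorems namespace `Summit.BirchSwinnertonDyer.BirchSwinnertonDyer.…` repeats the summit name by design (D-0017)
set_option linter.dupNamespace false

open scoped Classical NumberField ContRepresentation TensorProduct
open Field NumberField IsDedekindDomain
open WeierstrassCurve Literature.NumberTheory.EllipticCurves Literature.NumberTheory.GaloisRepresentations
  Literature.NumberTheory.GaloisRepresentations.DiscreteGaloisModule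
  Literature.NumberTheory.EllipticCurves.Kato2004.EulerSystemValues
open Summit.BirchSwinnertonDyer.Rank1Residual.GaloisImage
open Summit.BirchSwinnertonDyer.BirchSwinnertonDyer.Theorems.KimAtThreeFineKatoLevelExactness
open Summit.BirchSwinnertonDyer.BirchSwinnertonDyer.Theorems.KimAtThreeFineKatoLevelCompat

namespace Summit.BirchSwinnertonDyer.BirchSwinnertonDyer.Theorems.KimAtThreeFineKatoLevelCompatFactor

variable (W : WeierstrassCurve ℚ) [W.IsElliptic] (p : ℕ) [hp : Fact p.Prime]
  [ContinuousSMul ℤ_[p] (W.tateModule p)] (j k : ℕ) (r : Finset (HeightOneSpectrum (𝓞 ℚ)))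
  (v : HeightOneSpectrum (𝓞 ℚ)) (F : Type) [Field F] [Algebra (Place.Completion (Sum.inr v)) F]

/-- **Per-factor COMPAT, Galois side.**  For a field `F ⊇ ℚ_v` whose tower restriction lands in the
level `U = cycSubgroup p k r`, additive `φ_F` on `H¹(Γ_F, T_pE)` (tower action), `L_F` on `H¹(U, T_pE)`
and `e` on `H¹(ℚ_v, T_pE)` with (DEF_w) `L_F y = φ_F(loc_w y)` on cocycles and (RES_w)
`φ_F(res_{F/ℚ_v} h) = e h`: whenever `res_U κ₀ = Ψ′ y` (`Ψ′` computed on cocycles by `π_{j+1}`) and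
`loc_v κ₀ = π_{j+1,*} h`, **`e h − L_F y = p^{j+1} · φ_F y′` for some `y′ ∈ H¹(Γ_F, T_pE)`**.
[cite: Kim2022StructureSelmer, §3.4.1 and the proof of Thm. 3.13 (arXiv v3 pp. 26–27)] -/
theorem exists_sub_eq_zsmul_apply_of_factorDef
    (hU : ∀ σ, absGaloisRestrictTower ℚ (Place.Completion (Sum.inr v)) F σ ∈ cycSubgroup p k r)
    {V : Type} [AddCommGroup V]
    (φF : ((tateLocalRep W p (Sum.inr v)).restrict
      (absGaloisRestrict (Place.Completion (Sum.inr v)) F)).cohomology 1 →+ V)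
    (LF : H1 (tateRep W p) (cycSubgroup p k r) →+ V)
    (e : (tateLocalRep W p (Sum.inr v)).cohomology 1 →+ V)
    (hdef : ∀ (y : H1 (tateRep W p) (cycSubgroup p k r))
        (φ' : contOneCocycles (subgroupRep (tateRep W p).toTopRep (cycSubgroup p k r))),
        oneCocycleClass _ φ' = y →
        ∀ ψT : contOneCocycles ((tateLocalRep W p (Sum.inr v)).restrict
            (absGaloisRestrict (Place.Completion (Sum.inr v)) F)).toTopRep,
          (∀ σ, ψT.1 σ = φ'.1 ⟨absGaloisRestrictTower ℚ (Place.Completion (Sum.inr v)) F σ, hU σ⟩) →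
          LF y = φF (oneCocycleClass _ ψT))
    (hres : ∀ h : (tateLocalRep W p (Sum.inr v)).cohomology 1,
      φF (ContinuousRep.cohomologyRes (tateLocalRep W p (Sum.inr v))
        (absGaloisRestrict (Place.Completion (Sum.inr v)) F) 1 h) = e h)
    (Ψ : H1 (tateRep W p) (cycSubgroup p k r) →+
        continuousCohomology 1 (subgroupRep
          (W.torsionGaloisModule ((p : ℤ) ^ j * (p : ℤ))).toTopRep (cycSubgroup p k r)))
    (hΨ : ∀ (φ' : contOneCocycles (subgroupRep (tateRep W p).toTopRep (cycSubgroup p k r)))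
        (ψ : contOneCocycles (subgroupRep
          (W.torsionGaloisModule ((p : ℤ) ^ j * (p : ℤ))).toTopRep (cycSubgroup p k r))),
        (∀ g, ((ψ.1 g : geomTorsion W ((p : ℤ) ^ j * (p : ℤ))) : geomPoints W) =
          TateModule.proj p (j + 1) (φ'.1 g)) →
        Ψ (oneCocycleClass _ φ') = oneCocycleClass _ ψ)
    (y : H1 (tateRep W p) (cycSubgroup p k r))
    (κ₀ : galoisCohomology (W.torsionGaloisModule ((p : ℤ) ^ j * (p : ℤ))) 1)
    (h : (tateLocalRep W p (Sum.inr v)).cohomology 1)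
    (hresκ : resSubgroup (W.torsionGaloisModule ((p : ℤ) ^ j * (p : ℤ))).toTopRep (cycSubgroup p k r) 1 κ₀ =
      Ψ y)
    (hloc : galoisCohomology.localization (W.torsionGaloisModule ((p : ℤ) ^ j * (p : ℤ))) (Sum.inr v) 1 κ₀ =
      tateLocalMap W p j (Sum.inr v) h) :
    ∃ y' : ((tateLocalRep W p (Sum.inr v)).restrict
        (absGaloisRestrict (Place.Completion (Sum.inr v)) F)).cohomology 1,
      e h - LF y = ((p : ℤ) ^ (j + 1)) • φF y' := by
  classical
  obtain ⟨φ', rfl⟩ :=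
    oneCocycleClass_surjective (subgroupRep (tateRep W p).toTopRep (cycSubgroup p k r)) y
  obtain ⟨ψ, hψ⟩ := exists_level_pushCocycle W p j (cycSubgroup p k r) φ'
  have hΨy : Ψ (oneCocycleClass _ φ') = oneCocycleClass _ ψ :=
    hΨ φ' ψ fun g => by rw [hψ g, coe_tateToTorsion_apply]
  obtain ⟨ψT, hψT⟩ := exists_level_towerCocycle W p v F (cycSubgroup p k r) hU φ'
  -- `π_{j+1,*}(res_w h) = π_{j+1,*}[ψT]` in `H¹(Γ_F, E[p^j·p])`
  have hkey : ContinuousRep.cohomologyMap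
      ((tateLocalRep W p (Sum.inr v)).restrict (absGaloisRestrict (Place.Completion (Sum.inr v)) F))
      (((W.torsionGaloisModule ((p : ℤ) ^ j * (p : ℤ))).toLocal (Sum.inr v)).restrict
        (absGaloisRestrict (Place.Completion (Sum.inr v)) F))
      (tateToTorsion W p j) (continuous_tateToTorsion W p j) (tateToTorsion_tower_apply W p j v F) 1
      (ContinuousRep.cohomologyRes (tateLocalRep W p (Sum.inr v))
        (absGaloisRestrict (Place.Completion (Sum.inr v)) F) 1 h) =
    ContinuousRep.cohomologyMap
      ((tateLocalRep W p (Sum.inr v)).restrict (absGaloisRestrict (Place.Completion (Sum.inr v)) F))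
      (((W.torsionGaloisModule ((p : ℤ) ^ j * (p : ℤ))).toLocal (Sum.inr v)).restrict
        (absGaloisRestrict (Place.Completion (Sum.inr v)) F))
      (tateToTorsion W p j) (continuous_tateToTorsion W p j) (tateToTorsion_tower_apply W p j v F) 1
      (oneCocycleClass _ ψT) := by
    refine (cohomologyMap_cohomologyRes_eq_resTower_tateLocalMap W p j v F h).trans ?_
    refine (congrArg (resTower ℚ (Place.Completion (Sum.inr v)) F
      (W.torsionGaloisModule ((p : ℤ) ^ j * (p : ℤ))).toTopRep 1) hloc.symm).trans ?_
    refine (locTower_resSubgroup ℚ (Place.Completion (Sum.inr v)) F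
      (W.torsionGaloisModule ((p : ℤ) ^ j * (p : ℤ))).toTopRep (cycSubgroup p k r) hU 1 κ₀).symm.trans ?_
    refine (congrArg (locTower ℚ (Place.Completion (Sum.inr v)) F
      (W.torsionGaloisModule ((p : ℤ) ^ j * (p : ℤ))).toTopRep (cycSubgroup p k r) hU 1)
      (hresκ.trans hΨy)).trans ?_
    refine (locTower_oneCocycleClass ℚ (Place.Completion (Sum.inr v)) F
      (W.torsionGaloisModule ((p : ℤ) ^ j * (p : ℤ))).toTopRep (cycSubgroup p k r) hU ψ).trans ?_
    refine Eq.trans ?_ (cohomologyMap_tower_oneCocycleClass W p j v F ψT).symm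
    refine congrArg _ (Subtype.ext (ContinuousMap.ext fun σ => ?_))
    change ψ.1 (absGaloisRestrictTowerInto ℚ (Place.Completion (Sum.inr v)) F _ hU σ) =
      tateToTorsion W p j (ψT.1 σ)
    rw [hψ, hψT]
    rfl
  obtain ⟨y', hy'⟩ := exists_sub_eq_zsmul_tower W p j v F _ _ hkey
  refine ⟨y', ?_⟩
  rw [← hres h, hdef _ φ' rfl ψT hψT, ← map_sub, hy', map_zsmul]

/-- **Per-factor COMPAT with a lattice**: if moreover `M ⊇ range φ_F` (the per-factor `exp*`-lattice),
then `∃ μ ∈ M, e h − L_F y = p^{j+1} · μ` — the shape displayed by the 19560 LEAD's per-factor package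
(kim3 gen 14, HOME STATUS l.1162). [cite: Kim2022StructureSelmer, §3.4.1 and the proof of Thm. 3.13 (arXiv v3 pp. 26–27)] -/
theorem exists_mem_sub_eq_zsmul_of_factorDef
    (hU : ∀ σ, absGaloisRestrictTower ℚ (Place.Completion (Sum.inr v)) F σ ∈ cycSubgroup p k r)
    {V : Type} [AddCommGroup V]
    (φF : ((tateLocalRep W p (Sum.inr v)).restrict
      (absGaloisRestrict (Place.Completion (Sum.inr v)) F)).cohomology 1 →+ V)
    (LF : H1 (tateRep W p) (cycSubgroup p k r) →+ V)
    (e : (tateLocalRep W p (Sum.inr v)).cohomology 1 →+ V)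
    (M : AddSubgroup V) (hM : ∀ z, φF z ∈ M)
    (hdef : ∀ (y : H1 (tateRep W p) (cycSubgroup p k r))
        (φ' : contOneCocycles (subgroupRep (tateRep W p).toTopRep (cycSubgroup p k r))),
        oneCocycleClass _ φ' = y →
        ∀ ψT : contOneCocycles ((tateLocalRep W p (Sum.inr v)).restrict
            (absGaloisRestrict (Place.Completion (Sum.inr v)) F)).toTopRep,
          (∀ σ, ψT.1 σ = φ'.1 ⟨absGaloisRestrictTower ℚ (Place.Completion (Sum.inr v)) F σ, hU σ⟩) →
          LF y = φF (oneCocycleClass _ ψT))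
    (hres : ∀ h : (tateLocalRep W p (Sum.inr v)).cohomology 1,
      φF (ContinuousRep.cohomologyRes (tateLocalRep W p (Sum.inr v))
        (absGaloisRestrict (Place.Completion (Sum.inr v)) F) 1 h) = e h)
    (Ψ : H1 (tateRep W p) (cycSubgroup p k r) →+
        continuousCohomology 1 (subgroupRep
          (W.torsionGaloisModule ((p : ℤ) ^ j * (p : ℤ))).toTopRep (cycSubgroup p k r)))
    (hΨ : ∀ (φ' : contOneCocycles (subgroupRep (tateRep W p).toTopRep (cycSubgroup p k r)))
        (ψ : contOneCocycles (subgroupRep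
          (W.torsionGaloisModule ((p : ℤ) ^ j * (p : ℤ))).toTopRep (cycSubgroup p k r))),
        (∀ g, ((ψ.1 g : geomTorsion W ((p : ℤ) ^ j * (p : ℤ))) : geomPoints W) =
          TateModule.proj p (j + 1) (φ'.1 g)) →
        Ψ (oneCocycleClass _ φ') = oneCocycleClass _ ψ)
    (y : H1 (tateRep W p) (cycSubgroup p k r))
    (κ₀ : galoisCohomology (W.torsionGaloisModule ((p : ℤ) ^ j * (p : ℤ))) 1)
    (h : (tateLocalRep W p (Sum.inr v)).cohomology 1)
    (hresκ : resSubgroup (W.torsionGaloisModule ((p : ℤ) ^ j * (p : ℤ))).toTopRep (cycSubgroup p k r) 1 κ₀ =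
      Ψ y)
    (hloc : galoisCohomology.localization (W.torsionGaloisModule ((p : ℤ) ^ j * (p : ℤ))) (Sum.inr v) 1 κ₀ =
      tateLocalMap W p j (Sum.inr v) h) :
    ∃ μ ∈ M, e h - LF y = ((p : ℤ) ^ (j + 1)) • μ := by
  obtain ⟨y', hy'⟩ := exists_sub_eq_zsmul_apply_of_factorDef W p j k r v F hU φF LF e hdef hres Ψ hΨ
    y κ₀ h hresκ hloc
  exact ⟨φF y', hM y', hy'⟩

end Summit.BirchSwinnertonDyer.BirchSwinnertonDyer.Theorems.KimAtThreeFineKatoLevelCompatFactor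

end
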